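import Summits.BirchSwinnertonDyer.Rank1Residual.Additive.TameBranchLambdaParityLaw
import HarnessLib

/-!
# THE PARITY OF `λ` ON THE TAME BRANCH at rank zero — the TWO-SIDED sandwich
# `μ(X) + 2 ord #tors ≤ ord Ш[p^∞] + ord Reg_p + ord ∏c + ord ℓ ≤ μ(X) + ord_p B(0) + c + 2 ord #tors`
# (left `=` iff `λ(X) = 0`, right `=` iff `λ(X) = λ_an`), `λ(X)` EVEN, the DICHOTOMY at `λ_an = 2` and
# the SQUEEZE ⟹ the λ-part ⟹ the rational main conjecture AT THE PAIR
# (cell `b2b-bsdres`, sub-cell additive-p2 = X3♯(G-ord)/X4♯(G-ord), gen 30; part 3)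

HONEST FRAMING (cell `b2b-bsdres`, run/shared/lean/b2b/bsd-rank1-residual/, verbatim in every
file): the goal of the cell is to DELETE the COMBINATION-SHAPED residual classes of the
Birch–Swinnerton-Dyer formula for ALL analytic-rank `≤ 1` elliptic curves over `ℚ` — "full BSD
formula for every rank `≤ 1` curve in class `C`" assembled STRICTLY from published theorems — so
that the rank-`≤ 1` remainder becomes exactly the CONSTRUCTION-SHAPED classes, which are TYPED
(missing-input `Prop`s), NOT attempted. This is not "finishing BSD". Sub-cell additive-p2: the
classes X3♯(G-ord) / X4♯(G-ord) are CONSTRUCTION-SHAPED and stay so; labels / RESIDUAL-MAP marks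
UNCHANGED; nothing is booked. Theorems only; the published inputs are hypothesis binders (Delbourgo
2002 (B) as `LeadingTermClauses W p Dh`, (C) as the typed Kato half `TameBranchRatDvdAt W p` = A227 via
`tameBranchRatDvdAt_of_thmC`, Greenberg 1999 Prop. 3.10 as `prop310_selmerCorank_mod_two_eq_lambdaInvariant`).
No definition, no named fact, no `sorry`.

## What and why

The rank-zero twin of part 2. Per cyclotomic dual datum at `rank_ℤ E(ℚ) = 0` with the RATIONAL Kato
half `ι g = p^k·B` (`g ∈ char_Λ X = (fE)`), `B` bounded by `p^c` with `B(0) ≠ 0`, `LHS := ord_p #Ш[p^∞]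
+ ord_p Reg_p(E,Dh) + ord_p ∏c + ord_p ℓ`, `t := ord_p #E(ℚ)_tors`:

* gen 29 (UPPER): `LHS ≤ μ(fE) + ord_p B(0) + c + 2t`, and with FIRST TOP of `B` at `n`: `λ(fE) ≤ n`,
  `=` iff `λ(fE) = n`;
* §6 (LOWER): **`μ(fE) + 2t ≤ LHS`, `=` iff `λ(fE) = 0`** ((B) clause 3 at rank `0`:
  `fE(0)·#tors² = u·ℓ·#Ш[p^∞]·Reg_p·∏c`, and `μ(fE) ≤ ord_p fE(0)`, `=` iff `λ(fE) = 0`);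
* §6 (PARITY): **`λ(fE)` is EVEN** (Greenberg Prop. 3.10 at `corank Sel_{p^∞}(E/ℚ) = 0`), so
  `λ(fE) = 0 ∨ 2 ≤ λ(fE)`; at **`n = 2`: `λ(fE) ∈ {0, 2}`** — EXACTLY ONE of the two equalities holds;
* §6 (SQUEEZE): a certified `μ(fE) + 2t < LHS` — e.g. `μ(fE) ≤ m` and `m + 2t < ord_p ∏c_ℓ`, i.e. on
  X4 rows (`p ∤ #tors`) with `μ = 0` simply **`p ∣ ∏c_ℓ`** — forces `λ(fE) ≥ 2`, hence at `n = 2` the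
  λ-part, the identity `LHS = μ(fE) + ord_p B(0) + c + 2t`, and (part 1 §2) **`char_Λ X = (G)` with
  `ι G = p^{μ(fE)+c}·B`** (`charIdeal_eq_span_and_iota_eq_of_squeeze_rankZero`);
* §7 every defect ((M) included): the same from `TameBranchRatDvdAt W p` + ANY tuple
  (`B(0) = α⁻¹·[0]⁺_f`, `ord_p B(0) = ord_p[0]⁺_f`).

Window reading (EVIDENCE, gen 27 E-GAUSSCERT-R0 (R2); nothing booked): the nine X4-3 window rows with
`p ∣ [0]⁺_f` carry `λ_an = 2` (×8) or `4` (7350ca1@5); on the `λ_an = 2` rows the theorem says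
`λ(X) ∈ {0,2}` and `μ(X) = 0 ∧ p ∣ ∏c_ℓ·ℓ ⟹ λ(X) = 2` (two extra algebraic zeros at rank zero) and
the main conjecture (G) at the pair rationally. What this does NOT give: `μ`; a booking.

References: Delbourgo 2002 Thm. (A), (B), (C) p. 40 [Delbourgo2002]; Greenberg LNM 1716 Prop. 3.10 and
§5 p. 183 [GreenbergLNM1716]; Greenberg–Vatsal 2000 p. 4 [GreenbergVatsal2000]; Washington GTM 83 §7.1
[Washington1997]; `X1/ParitySqueeze.lean` (eisenstein-p1, route P at `147b1@13`),
`TameBranchExtraZerosRankZero.lean` (gen 29). -/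

set_option autoImplicit false

noncomputable section

open scoped Classical MatrixGroups ModularForm NumberField

open CongruenceSubgroup IsDedekindDomain WeierstrassCurve NumberField
  Literature.NumberTheory.EllipticCurves
  Literature.NumberTheory.EllipticCurves.ModularForms
  Literature.NumberTheory.EllipticCurves.Rank1Residual
  Literature.NumberTheory.EllipticCurves.Rank1Residual.Typed
  Literature.NumberTheory.EllipticCurves.Delbourgo2002
  Literature.NumberTheory.EllipticCurves.Greenberg1999
  Summit.BirchSwinnertonDyer.Rank1Residual.X1.MuLambda
  Summit.BirchSwinnertonDyer.Rank1Residual.X1.ParitySqueeze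
  Summit.BirchSwinnertonDyer.Rank1Residual.X1.RankOneParitySqueeze
  Summit.BirchSwinnertonDyer.Rank1Residual.X11a.LambdaNorm

namespace Summit.BirchSwinnertonDyer.Rank1Residual.Additive

/-! ### §6 Rank zero, per cyclotomic datum: sandwich, parity, dichotomy, squeeze -/

section CoreZero

open TameBranchExtraZeros TameBranchLambdaParity

variable {W : WeierstrassCurve ℚ} [W.IsElliptic] [W.IsGloballyMinimal] {p : ℕ} [hp : Fact p.Prime]

/-- **THE TWO-SIDED SANDWICH WITH PARITY AT RANK ZERO (per cyclotomic datum).** `p ≠ 2`,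
`rank_ℤ E(ℚ) = 0`, a (B)-datum `Dh`, a cyclotomic dual datum `D` with `X` torsion and generator `fE`,
`g ∈ char_Λ X` with `ι g = p^k·B`, `‖[Tʲ]B‖ ≤ p^c`, `B(0) ≠ 0`, Greenberg's Prop. 3.10 (`h310`). With
`LHS = ord_p #Ш[p^∞] + ord_p Reg_p + ord_p ∏c + ord_p ℓ`, `t = ord_p #tors`: Schneider (rank-`0` shape),
`#Ш[p^∞] < ∞`, **`λ(fE)` EVEN**, `λ(fE) = 0 ∨ 2 ≤ λ(fE)`; **`μ(fE) + 2t ≤ LHS` (`=` iff `λ(fE) = 0`)**,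
`LHS ≤ μ(fE) + ord_p B(0) + c + 2t`; the SQUEEZE `μ(fE) + 2t < LHS ⟹ 2 ≤ λ(fE)`; and if `B` has its
FIRST TOP at `n`: `λ(fE) ≤ n`, upper `=` iff `λ(fE) = n`, at `n = 2` the DICHOTOMY `λ(fE) ∈ {0, 2}` and
**`μ(fE) + 2t < LHS ⟹ λ(fE) = 2` with the upper equality**.
[cite: Delbourgo2002, Theorem (B) (p. 40)] [cite: GreenbergLNM1716, Prop. 3.10 and §5 p. 183]
[cite: Washington1997, §7.1] -/
theorem sandwich_rankZero_of_iota_eq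
    (h310 : prop310_selmerCorank_mod_two_eq_lambdaInvariant) (hp2 : p ≠ 2)
    (hr0 : W.mordellWeilRank = 0) {Dh : PAdicHeightData W p} (hBcl : LeadingTermClauses W p Dh)
    {κ : ZpExtension ℚ p} {γ : Field.absoluteGaloisGroup ℚ}
    (hκ : κ.IsCyclotomic) (hγ : κ.IsTopGenerator γ) (hγ' : IsCyclotomicVariable p γ)
    (D : W.SelmerDualData κ γ) [Module.Finite (IwasawaAlgebra p) D.X] (hX : D.IsTorsion)
    {fE g : IwasawaAlgebra p} (hchar : D.charIdeal = Ideal.span {fE}) (hg : g ∈ D.charIdeal)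
    {k c : ℕ} {B : PowerSeries ℚ_[p]}
    (hι : iwasawaToPowerSeries p g = PowerSeries.C ((p : ℚ_[p]) ^ k) * B)
    (hbd : ∀ j : ℕ, ‖PowerSeries.coeff j B‖ ≤ (p : ℝ) ^ c) (hB0 : PowerSeries.constantCoeff B ≠ 0) :
    SchneiderConjecture Dh ∧ Finite (AddCommGroup.primaryComponent W.sha p) ∧
      Even (lam fE) ∧ (lam fE = 0 ∨ 2 ≤ lam fE) ∧
      ∃ ℓ : ℕ, ℓ ∣ p ^ 2 ∧ (ReductionNonAnomalous W p → ℓ = 1) ∧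
        (X1.MuLambda.mu fE : ℤ) + 2 * padicValNat p W.torsionOrder ≤
          (padicValNat p (Nat.card (AddCommGroup.primaryComponent W.sha p)) : ℤ) +
            (padicRegulator Dh).valuation + padicValNat p W.tamagawaProduct + padicValNat p ℓ ∧
        ((X1.MuLambda.mu fE : ℤ) + 2 * padicValNat p W.torsionOrder =
          (padicValNat p (Nat.card (AddCommGroup.primaryComponent W.sha p)) : ℤ) +
            (padicRegulator Dh).valuation + padicValNat p W.tamagawaProduct + padicValNat p ℓ ↔
          lam fE = 0) ∧
        (padicValNat p (Nat.card (AddCommGroup.primaryComponent W.sha p)) : ℤ) +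
            (padicRegulator Dh).valuation + padicValNat p W.tamagawaProduct + padicValNat p ℓ ≤
          X1.MuLambda.mu fE + (PowerSeries.constantCoeff B).valuation + c +
            2 * padicValNat p W.torsionOrder ∧
        ((X1.MuLambda.mu fE : ℤ) + 2 * padicValNat p W.torsionOrder <
          (padicValNat p (Nat.card (AddCommGroup.primaryComponent W.sha p)) : ℤ) +
            (padicRegulator Dh).valuation + padicValNat p W.tamagawaProduct + padicValNat p ℓ →
          2 ≤ lam fE) ∧
        ∀ n : ℕ, ‖PowerSeries.coeff n B‖ = (p : ℝ) ^ c → (∀ i < n, ‖PowerSeries.coeff i B‖ < (p : ℝ) ^ c) →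
          lam fE ≤ n ∧
          ((padicValNat p (Nat.card (AddCommGroup.primaryComponent W.sha p)) : ℤ) +
              (padicRegulator Dh).valuation + padicValNat p W.tamagawaProduct + padicValNat p ℓ =
            X1.MuLambda.mu fE + (PowerSeries.constantCoeff B).valuation + c +
              2 * padicValNat p W.torsionOrder ↔ lam fE = n) ∧
          (n = 2 → lam fE = 0 ∨ lam fE = 2) ∧
          (n = 2 → (X1.MuLambda.mu fE : ℤ) + 2 * padicValNat p W.torsionOrder <
            (padicValNat p (Nat.card (AddCommGroup.primaryComponent W.sha p)) : ℤ) +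
              (padicRegulator Dh).valuation + padicValNat p W.tamagawaProduct + padicValNat p ℓ →
            lam fE = 2 ∧
            (padicValNat p (Nat.card (AddCommGroup.primaryComponent W.sha p)) : ℤ) +
              (padicRegulator Dh).valuation + padicValNat p W.tamagawaProduct + padicValNat p ℓ =
            X1.MuLambda.mu fE + (PowerSeries.constantCoeff B).valuation + c +
              2 * padicValNat p W.torsionOrder) := by
  have hpP : p.Prime := hp.out
  have hpQ : (p : ℚ_[p]) ≠ 0 := Nat.cast_ne_zero.mpr hpP.ne_zero
  -- the factorisation `g = fE · h`
  have hg' := hg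
  rw [hchar] at hg'
  obtain ⟨h, hh⟩ := Ideal.mem_span_singleton'.mp hg'
  have hfac : g = fE * h := by rw [← hh, mul_comm]
  obtain ⟨hf0, hle, hiffn⟩ := valuation_constantCoeff_le hfac hι hbd hB0
  have hg0 : g ≠ 0 := by
    intro h0
    have e : ((PowerSeries.constantCoeff g : ℤ_[p]) : ℚ_[p]) =
        (p : ℚ_[p]) ^ k * PowerSeries.constantCoeff B := by
      rw [← constantCoeff_iwasawaToPowerSeries p g, hι, map_mul, PowerSeries.constantCoeff_C]
    rw [h0] at e
    simp only [map_zero, PadicInt.coe_zero] at e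
    exact (mul_ne_zero (pow_ne_zero _ hpQ) hB0) e.symm
  have hfE0 : fE ≠ 0 := by intro h0; apply hg0; rw [hfac, h0, zero_mul]
  have hh0 : h ≠ 0 := by intro h0; apply hg0; rw [hfac, h0, mul_zero]
  have hlam_mul : lam g = lam fE + lam h := by rw [hfac]; exact lam_mul hfE0 hh0
  -- `ord_T fE = 0 = rank`
  have hcl := hBcl κ γ hκ hγ hγ' D hX fE hchar
  have hf0Z : PowerSeries.constantCoeff fE ≠ 0 := by
    intro e; apply hf0; rw [e]; simp
  have horder : fE.order = 0 := by
    rw [← Nat.cast_zero (R := ℕ∞), PowerSeries.order_eq_nat]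
    refine ⟨by rwa [PowerSeries.coeff_zero_eq_constantCoeff_apply], fun i hi ↦ ?_⟩
    omega
  have horder' : fE.order = W.mordellWeilRank := by rw [hr0, horder, Nat.cast_zero]
  obtain ⟨hS, hfin⟩ := hcl.2.1.mp horder'
  -- PARITY (Greenberg Prop. 3.10): `λ(fE)` even
  have heven : Even (lam fE) := even_lam_generator_of_rank_zero h310 hp2 hr0 hκ hγ D hX hfE0 hchar hfin
  have hpar : lam fE = 0 ∨ 2 ≤ lam fE := by
    obtain ⟨j, hj⟩ := heven
    omega
  -- the LOWER sandwich at index `0`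
  obtain ⟨hlow, hlowiff⟩ := mu_le_valuation_constantCoeff hfE0 hf0
  -- clause 3 of (B) in rank zero
  obtain ⟨u, ℓ, hℓp, hℓ1, heq⟩ := hcl.2.2 hS hfin
  rw [hr0, pow_zero, mul_one, PowerSeries.coeff_zero_eq_constantCoeff_apply] at heq
  have hT0 : W.torsionOrder ≠ 0 := (W.torsionOrder_pos_holds).ne'
  have hTQ : (W.torsionOrder : ℚ_[p]) ≠ 0 := by exact_mod_cast hT0
  have hu0 : ((u : ℤ_[p]) : ℚ_[p]) ≠ 0 := coe_units_ne_zero p u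
  have hℓ0 : ℓ ≠ 0 := by
    rintro rfl
    exact hpP.ne_zero (pow_eq_zero_iff (n := 2) (by norm_num) |>.mp (zero_dvd_iff.mp hℓp))
  have hℓQ : (ℓ : ℚ_[p]) ≠ 0 := by exact_mod_cast hℓ0
  haveI : Finite (AddCommGroup.primaryComponent W.sha p) := hfin
  have hShp0 : (Nat.card (AddCommGroup.primaryComponent W.sha p) : ℚ_[p]) ≠ 0 := by
    exact_mod_cast Nat.card_pos.ne'
  have hRg0 : padicRegulator Dh ≠ 0 := hS
  have hCc0 : (W.tamagawaProduct : ℚ_[p]) ≠ 0 := by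
    exact_mod_cast (W.tamagawaProduct_pos_holds : 0 < W.tamagawaProduct).ne'
  have hL : (((PowerSeries.constantCoeff fE : ℤ_[p]) : ℚ_[p]) * (W.torsionOrder : ℚ_[p]) ^ 2).valuation =
      (((PowerSeries.constantCoeff fE : ℤ_[p]) : ℚ_[p])).valuation +
        2 * (padicValNat p W.torsionOrder : ℤ) := by
    rw [Padic.valuation_mul hf0 (pow_ne_zero 2 hTQ), Padic.valuation_pow, Padic.valuation_natCast]
    push_cast
    ring
  have hR : (((u : ℤ_[p]) : ℚ_[p]) * (ℓ : ℚ_[p]) *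
        ((Nat.card (AddCommGroup.primaryComponent W.sha p) : ℚ_[p]) * padicRegulator Dh *
          (W.tamagawaProduct : ℚ_[p]))).valuation =
      (padicValNat p ℓ : ℤ) +
        ((padicValNat p (Nat.card (AddCommGroup.primaryComponent W.sha p)) : ℤ) +
          (padicRegulator Dh).valuation + padicValNat p W.tamagawaProduct) := by
    rw [Padic.valuation_mul (mul_ne_zero hu0 hℓQ) (mul_ne_zero (mul_ne_zero hShp0 hRg0) hCc0),
      Padic.valuation_mul hu0 hℓQ, valuation_coe_units_eq_zero, zero_add, Padic.valuation_natCast,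
      Padic.valuation_mul (mul_ne_zero hShp0 hRg0) hCc0, Padic.valuation_mul hShp0 hRg0,
      Padic.valuation_natCast, Padic.valuation_natCast]
  have hval := congrArg Padic.valuation heq
  rw [hL, hR] at hval
  -- the lower equality criterion in terms of `λ(fE) = 0`
  have hlowiff' : ((X1.MuLambda.mu fE : ℤ) + 2 * padicValNat p W.torsionOrder =
      (padicValNat p (Nat.card (AddCommGroup.primaryComponent W.sha p)) : ℤ) +
        (padicRegulator Dh).valuation + padicValNat p W.tamagawaProduct + padicValNat p ℓ ↔
      lam fE = 0) := by
    rw [← hlowiff]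
    constructor
    · intro e; linarith
    · intro e; linarith
  have hsq : (X1.MuLambda.mu fE : ℤ) + 2 * padicValNat p W.torsionOrder <
      (padicValNat p (Nat.card (AddCommGroup.primaryComponent W.sha p)) : ℤ) +
        (padicRegulator Dh).valuation + padicValNat p W.tamagawaProduct + padicValNat p ℓ →
      2 ≤ lam fE := by
    intro hlt'
    rcases hpar with h0' | h2
    · exfalso
      have e := hlowiff'.mpr h0'
      linarith
    · exact h2
  refine ⟨hS, hfin, heven, hpar, ℓ, hℓp, hℓ1, by linarith, hlowiff', by linarith, hsq,
    fun n hn hlt ↦ ?_⟩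
  have hlamg : lam g = n := lam_eq_of_iota_eq_of_firstTop hg0 hι hbd hn hlt
  have hlamn : lam fE ≤ n := by rw [← hlamg, hlam_mul]; exact Nat.le_add_right _ _
  have hupiff : ((padicValNat p (Nat.card (AddCommGroup.primaryComponent W.sha p)) : ℤ) +
        (padicRegulator Dh).valuation + padicValNat p W.tamagawaProduct + padicValNat p ℓ =
      X1.MuLambda.mu fE + (PowerSeries.constantCoeff B).valuation + c +
        2 * padicValNat p W.torsionOrder ↔ lam fE = n) := by
    rw [← hlamg, ← hiffn n hn]
    constructor
    · intro e; linarith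
    · intro e; linarith
  refine ⟨hlamn, hupiff, fun h2 ↦ by omega, fun h2 hlt' ↦ ?_⟩
  have hlam2 : lam fE = 2 := by
    have := hsq hlt'
    omega
  exact ⟨hlam2, hupiff.mpr (by rw [hlam2, h2])⟩

/-- **THE SQUEEZE ⟹ THE RATIONAL MAIN CONJECTURE AT THE PAIR (rank zero, `λ_an = 2`).** In the setting of
`sandwich_rankZero_of_iota_eq` with the FIRST TOP of `B` at `2`, a certified `μ(fE) ≤ m` and the per-pair
inequality `m + 2·ord_p #E(ℚ)_tors < ord_p ∏c_ℓ` (`ord_p #Ш[p^∞], ord_p ℓ ≥ 0` dropped; `Reg_p = 1` in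
rank `0`, `padicRegulator_eq_one_of_finite`): then **`λ(fE) = 2`** and **`char_Λ X = (G)` with
`ι G = p^{μ(fE)+c}·B`** (exponent identified). With `m = 0` on an X4 row (`p ∤ #tors`):
`μ(X) = 0 ∧ p ∣ ∏c_ℓ` gives the main conjecture (G) at the pair rationally — the tame-branch twin of
Greenberg's squeeze at `147b1@13`. [cite: Delbourgo2002, Theorem (B), (C) (p. 40)]
[cite: GreenbergLNM1716, Prop. 3.10 and §5 p. 183] [cite: GreenbergVatsal2000, p. 4]
[cite: MazurTateTeitelbaum1986Invent, §II.4] [cite: Washington1997, §7.1] -/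
theorem charIdeal_eq_span_and_iota_eq_of_squeeze_rankZero
    (h310 : prop310_selmerCorank_mod_two_eq_lambdaInvariant) (hp2 : p ≠ 2)
    (hr0 : W.mordellWeilRank = 0) {Dh : PAdicHeightData W p} (hBcl : LeadingTermClauses W p Dh)
    {κ : ZpExtension ℚ p} {γ : Field.absoluteGaloisGroup ℚ}
    (hκ : κ.IsCyclotomic) (hγ : κ.IsTopGenerator γ) (hγ' : IsCyclotomicVariable p γ)
    (D : W.SelmerDualData κ γ) [Module.Finite (IwasawaAlgebra p) D.X] (hX : D.IsTorsion)
    {fE g : IwasawaAlgebra p} (hchar : D.charIdeal = Ideal.span {fE}) (hg : g ∈ D.charIdeal)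
    {k c : ℕ} {B : PowerSeries ℚ_[p]}
    (hι : iwasawaToPowerSeries p g = PowerSeries.C ((p : ℚ_[p]) ^ k) * B)
    (hbd : ∀ j : ℕ, ‖PowerSeries.coeff j B‖ ≤ (p : ℝ) ^ c) (hB0 : PowerSeries.constantCoeff B ≠ 0)
    (hn : ‖PowerSeries.coeff 2 B‖ = (p : ℝ) ^ c) (hlt : ∀ i < 2, ‖PowerSeries.coeff i B‖ < (p : ℝ) ^ c)
    {m : ℕ} (hμ : X1.MuLambda.mu fE ≤ m)
    (hb : m + 2 * padicValNat p W.torsionOrder < padicValNat p W.tamagawaProduct) :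
    lam fE = 2 ∧
      ∃ G : IwasawaAlgebra p, D.charIdeal = Ideal.span {G} ∧
        X1.MuLambda.mu G = X1.MuLambda.mu fE ∧ lam G = 2 ∧
        iwasawaToPowerSeries p G = PowerSeries.C ((p : ℚ_[p]) ^ (X1.MuLambda.mu fE + c)) * B := by
  have hpQ : (p : ℚ_[p]) ≠ 0 := Nat.cast_ne_zero.mpr hp.out.ne_zero
  obtain ⟨-, hfin, -, -, ℓ, -, -, -, -, -, -, hrest⟩ :=
    sandwich_rankZero_of_iota_eq h310 hp2 hr0 hBcl hκ hγ hγ' D hX hchar hg hι hbd hB0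
  obtain ⟨-, -, -, hsq2⟩ := hrest 2 hn hlt
  haveI : Finite (AddCommGroup.primaryComponent W.sha p) := hfin
  haveI : Finite W.toAffine.Point := W.mordellWeilRank_eq_zero_iff_finite.mp hr0
  have hReg : (padicRegulator Dh).valuation = 0 := by
    rw [padicRegulator_eq_one_of_finite W p Dh, Padic.valuation_one]
  have hSh : (0 : ℤ) ≤ padicValNat p (Nat.card (AddCommGroup.primaryComponent W.sha p)) := by
    exact_mod_cast Nat.zero_le _
  have hℓv : (0 : ℤ) ≤ padicValNat p ℓ := by exact_mod_cast Nat.zero_le _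
  have hμ' : (X1.MuLambda.mu fE : ℤ) ≤ m := by exact_mod_cast hμ
  have hb' : (m : ℤ) + 2 * padicValNat p W.torsionOrder < padicValNat p W.tamagawaProduct := by
    exact_mod_cast hb
  obtain ⟨hlam2, -⟩ := hsq2 rfl (by linarith)
  refine ⟨hlam2, ?_⟩
  have hg' := hg
  rw [hchar] at hg'
  obtain ⟨h, hh⟩ := Ideal.mem_span_singleton'.mp hg'
  have hfac : g = fE * h := by rw [← hh, mul_comm]
  have hg0 : g ≠ 0 := by
    intro h0
    have e : ((PowerSeries.constantCoeff g : ℤ_[p]) : ℚ_[p]) =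
        (p : ℚ_[p]) ^ k * PowerSeries.constantCoeff B := by
      rw [← constantCoeff_iwasawaToPowerSeries p g, hι, map_mul, PowerSeries.constantCoeff_C]
    rw [h0] at e
    simp only [map_zero, PadicInt.coe_zero] at e
    exact (mul_ne_zero (pow_ne_zero _ hpQ) hB0) e.symm
  have hlamg : lam g = 2 := TameBranchExtraZeros.lam_eq_of_iota_eq_of_firstTop hg0 hι hbd hn hlt
  have hlameq : lam fE = lam g := by rw [hlam2, hlamg]
  obtain ⟨-, hspan, hμG, hlamG, -⟩ :=
    TameBranchLambdaParity.exists_span_eq_and_iota_eq_zpow_of_lam_eq hfac hg0 hι hlameq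
  obtain ⟨-, hιG⟩ := TameBranchLambdaParity.iota_eq_pow_mu_add_of_lam_eq hfac hg0 hι hbd hn hlameq
  exact ⟨fE * pfree h, by rw [hchar, hspan], hμG, by rw [hlamG, hlam2], hιG⟩

end CoreZero

/-! ### §7 Rank zero, every defect: the typed Kato half + ANY tuple — `B(0) = α⁻¹·[0]⁺_f` -/

section EveryDefectZero

open TameBranchExtraZeros TameBranchLambdaParity

variable {W : WeierstrassCurve ℚ} [W.IsElliptic] [W.IsGloballyMinimal] {p : ℕ} [hp : Fact p.Prime]
  {N : ℕ} [NeZero N] {f : CuspForm (Gamma0 N) 2}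

/-- **RANK ZERO, every defect ((M) included): sandwich, parity, dichotomy, squeeze.** `p ≠ 2` additive
of type (M) or (G-ord), `TameBranchRatDvdAt W p`, ANY tuple `(f, ε, α, B)` of the package (bound `p^c`),
`rank_ℤ E(ℚ) = 0`, `[0]⁺_f ≠ 0`, a (B)-datum, Greenberg's Prop. 3.10. Then for every cyclotomic dual datum
with generator `fE`: `#Ш[p^∞] < ∞`, **`λ(fE)` EVEN**, **`μ(fE) + 2t ≤ LHS ≤ μ(fE) + ord_p[0]⁺_f + c + 2t`**
(left `=` iff `λ(fE) = 0`), the squeeze `μ(fE) + 2t < LHS ⟹ 2 ≤ λ(fE)`, and with a FIRST TOP at `n`: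
`λ(fE) ≤ n`, right `=` iff `λ(fE) = n`, at `n = 2` the dichotomy `λ(fE) ∈ {0,2}` and
`μ(fE) + 2t < LHS ⟹ λ(fE) = 2` with the upper equality.
[cite: Delbourgo2002, Theorem (A), (B), (C) (p. 40)] [cite: GreenbergLNM1716, Prop. 3.10]
[cite: Washington1997, §7.1] -/
theorem sandwich_rankZero_of_tameBranchRatDvdAt
    (h310 : prop310_selmerCorank_mod_two_eq_lambdaInvariant) (hT : TameBranchRatDvdAt W p)
    {ε : DirichletCharacter ℂ_[p] p} {α : ℚ_[p]} {B : PowerSeries ℚ_[p]}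
    (hp2 : p ≠ 2) (hadd : Addv W p) (hloc : PotMult W p ∨ TypeGOrd W p)
    (hf : IsNewformOf W f) (hε : orderOf ε = tameDefect W p) (hα : ‖α‖ = 1)
    (hB : IsTameBranchOf f p ε α B) {c : ℕ} (hbd : ∀ j : ℕ, ‖PowerSeries.coeff j B‖ ≤ (p : ℝ) ^ c)
    (h0 : ratPlusSymbol f 0 ≠ 0)
    (hr0 : W.mordellWeilRank = 0) {Dh : PAdicHeightData W p} (hBcl : LeadingTermClauses W p Dh)
    {κ : ZpExtension ℚ p} {γ : Field.absoluteGaloisGroup ℚ}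
    (hκ : κ.IsCyclotomic) (hγ : κ.IsTopGenerator γ) (hγ' : IsCyclotomicVariable p γ)
    (D : W.SelmerDualData κ γ) [Module.Finite (IwasawaAlgebra p) D.X]
    {fE : IwasawaAlgebra p} (hchar : D.charIdeal = Ideal.span {fE}) :
    Finite (AddCommGroup.primaryComponent W.sha p) ∧ Even (lam fE) ∧ (lam fE = 0 ∨ 2 ≤ lam fE) ∧
      ∃ ℓ : ℕ, ℓ ∣ p ^ 2 ∧ (ReductionNonAnomalous W p → ℓ = 1) ∧
        (X1.MuLambda.mu fE : ℤ) + 2 * padicValNat p W.torsionOrder ≤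
          (padicValNat p (Nat.card (AddCommGroup.primaryComponent W.sha p)) : ℤ) +
            (padicRegulator Dh).valuation + padicValNat p W.tamagawaProduct + padicValNat p ℓ ∧
        ((X1.MuLambda.mu fE : ℤ) + 2 * padicValNat p W.torsionOrder =
          (padicValNat p (Nat.card (AddCommGroup.primaryComponent W.sha p)) : ℤ) +
            (padicRegulator Dh).valuation + padicValNat p W.tamagawaProduct + padicValNat p ℓ ↔
          lam fE = 0) ∧
        (padicValNat p (Nat.card (AddCommGroup.primaryComponent W.sha p)) : ℤ) +
            (padicRegulator Dh).valuation + padicValNat p W.tamagawaProduct + padicValNat p ℓ ≤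
          X1.MuLambda.mu fE + padicValRat p (ratPlusSymbol f 0) + c + 2 * padicValNat p W.torsionOrder ∧
        ((X1.MuLambda.mu fE : ℤ) + 2 * padicValNat p W.torsionOrder <
          (padicValNat p (Nat.card (AddCommGroup.primaryComponent W.sha p)) : ℤ) +
            (padicRegulator Dh).valuation + padicValNat p W.tamagawaProduct + padicValNat p ℓ →
          2 ≤ lam fE) ∧
        ∀ n : ℕ, ‖PowerSeries.coeff n B‖ = (p : ℝ) ^ c → (∀ i < n, ‖PowerSeries.coeff i B‖ < (p : ℝ) ^ c) →
          lam fE ≤ n ∧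
          ((padicValNat p (Nat.card (AddCommGroup.primaryComponent W.sha p)) : ℤ) +
              (padicRegulator Dh).valuation + padicValNat p W.tamagawaProduct + padicValNat p ℓ =
            X1.MuLambda.mu fE + padicValRat p (ratPlusSymbol f 0) + c + 2 * padicValNat p W.torsionOrder ↔
            lam fE = n) ∧
          (n = 2 → lam fE = 0 ∨ lam fE = 2) ∧
          (n = 2 → (X1.MuLambda.mu fE : ℤ) + 2 * padicValNat p W.torsionOrder <
            (padicValNat p (Nat.card (AddCommGroup.primaryComponent W.sha p)) : ℤ) +
              (padicRegulator Dh).valuation + padicValNat p W.tamagawaProduct + padicValNat p ℓ →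
            lam fE = 2 ∧
            (padicValNat p (Nat.card (AddCommGroup.primaryComponent W.sha p)) : ℤ) +
              (padicRegulator Dh).valuation + padicValNat p W.tamagawaProduct + padicValNat p ℓ =
            X1.MuLambda.mu fE + padicValRat p (ratPlusSymbol f 0) + c + 2 * padicValNat p W.torsionOrder) := by
  obtain ⟨hX, g, hg, k, hι⟩ := hT ε α B hp2 hadd hloc hκ hγ hγ' hf hε hα hB D
  have h0Q : ((ratPlusSymbol f 0 : ℚ) : ℚ_[p]) ≠ 0 := by exact_mod_cast h0
  have hα0 : α ≠ 0 := by intro e; rw [e, norm_zero] at hα; exact zero_ne_one hα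
  have hB0' : PowerSeries.constantCoeff B = α⁻¹ * ((ratPlusSymbol f 0 : ℚ) : ℚ_[p]) := hB.constantCoeff
  have hB0 : PowerSeries.constantCoeff B ≠ 0 := by
    rw [hB0']; exact mul_ne_zero (inv_ne_zero hα0) h0Q
  have hvB : (PowerSeries.constantCoeff B).valuation = padicValRat p (ratPlusSymbol f 0) := by
    have hαv : (α⁻¹).valuation = 0 := by
      have h1 : ‖α⁻¹‖ = (p : ℝ) ^ (0 : ℕ) := by rw [norm_inv, hα, inv_one, pow_zero]
      have := (norm_eq_pow_iff_valuation_eq (inv_ne_zero hα0) 0).mp h1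
      simpa using this
    rw [hB0', Padic.valuation_mul (inv_ne_zero hα0) h0Q, hαv, zero_add, Padic.valuation_ratCast]
  obtain ⟨-, hfin, heven, hpar, ℓ, hℓ, hna, hlow, hlowiff, hup, hsq, hrest⟩ :=
    sandwich_rankZero_of_iota_eq h310 hp2 hr0 hBcl hκ hγ hγ' D hX hchar hg hι hbd hB0
  rw [hvB] at hup hrest
  exact ⟨hfin, heven, hpar, ℓ, hℓ, hna, hlow, hlowiff, hup, hsq, hrest⟩

end EveryDefectZero

end Summit.BirchSwinnertonDyer.Rank1Residual.Additive

end
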